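import Summits.QuantumFields.YangMills.Theorems.BalabanUVNodesN15TwoSpacingGluingCurvedKnitCovariantAveragingPair
import Summits.QuantumFields.YangMills.Theorems.BalabanUVNodesN15TwoSpacingGluingCurvedKnitCovariantLandauEtaDefect
import Summits.QuantumFields.YangMills.Theorems.BalabanUVNodesN15TwoSpacingGluingCurvedKnitCap
import Summits.QuantumFields.YangMills.Theorems.BalabanUVNodesN15TwoSpacingGluingCurvedKnitFineCap
import HarnessLib

/-!
# N15 = NE2 — dag-n15-a g32 (t2), F2: THE GLUED PROPAGATOR PAIR `(X_r, X′_r)` OF THE COVER WITH BAŁABAN's FULLY COVARIANT SUMMAND `a·Q*(U)Q(U) − D_U(I − R(U))D*_U` LIVE — block locality and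
# the two inverse identities on BOTH grids, rate-capped, n15-c∕211's one-grid Landau rows DISPLAYED (n15-c∕191 `sfq_cvGlued_pair_spec`'s (P-R) twin)
# (dag-n15-a g32, (t2) FILE F2; node N15 = NE2; `--supports stmt-QuantumFields-27366 --as helper`, count-neutral; ONE theorem; imports 191, 206, 208, F1)

WHY.  PROGRAMME 𝟙P «ONE PROPAGATOR» made the site ∕ unit sandwiches and the all-layers literal generic in the inner propagator family, fed by three increment rows ((𝟙P-b)∕(𝟙P-c)∕(𝟙P-d));
the rows of a live-summand propagator come from (𝟙P-g)'s socket `hasMaj_sub_tensorId_gOp_of_liveSummand(_fine)`, which asks, per grid, the propagator's block decay and its right-inverse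
identity against `Δ_{Ad U} + (N_L − N_V)`.  For dag-n15-c's (P-Q) propagator `X_q` those came from n15-c∕191.  dag-n15-c's (P-R) propagator `X_r` — the pair inside n15-c∕207a `sfqrEntry0`,
summand `N_L ⊗ 1 − N_V^Q − N_V^R`, perturbation `N_V^Q + N_V^R`, `N_V^R = D_U(I−R(U))D*_U − ∂Π∂* ⊗ 1_ι` (n15-c∕201∕206 `cvNVr`, `cvNVr'`) — has no pair spec in the tree (n15-c∕204
`sfqr_cvGlued_spec` is one grid, Hermitian parametrisation, un-capped).  This file supplies it, in 191's skew two-grid parametrisation, over the δ-CAPPED knits (n15-c∕208, F1) so that the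
displayed Landau rows — known at THEIR rate `δ_R` (n15-c∕211 `hG`) — can be fed in (`δ_e := δ_R`; the knit's internal rates are `≤ δ_e`).

WHAT.  ★★ `sfqr_cvGlued_pair_spec … (hδe : 0 < δe) : ∃ δ ≤ δe, w₀ R₀ θ₀ R₁ B, …` — statement in the theorem's docstring; displayed, beyond 191's: ONE Landau letter `ρ_R ≥ 0` in the two
budgets and the two one-grid global rows `N_V^R(e^{ηĀ′}) ≤ ρ_R e^{−δ_e d}` (coarse sharp blocks), `N_V^R′(e^{η′A′}) ≤ ρ_R e^{−δ_e d}` (fine blocks `cvBlk∘π̂`, n15-c∕211's spelling); proof =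
191's text VERBATIM with `uN_cvGlued_spec_cap`∕`uN_cvGlued'_spec_cap`, the conjugation law by n15-c's `conj_one_eq_sub_zero` + `sub_sub`, and the near∕far rows of `N_V^Q + N_V^R` split
(`LinearMap.add_comp`∕`comp_add`) into 191's `N_V^Q` rows plus the sandwiched Landau rows (n15-c∕183 `hasMaj_sandwich_of_abs_le_one`, cut-offs bounded by one; fine blocks respelled by
`blkFine_comp_kingPrV`).

HONEST FRAMING ∕ LIMITS.  MODEL operator ∕ class ∕ carriers (doubled-torus cover; global small-field gauge; `Q(U)` = main term (125) of [B7] (124); crude constants); the two Landau rows are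
HYPOTHESES (dag-n15-c's located-next analytic object: sup-norm kernel rows for the covariant Green families, [B9] §1∕(3.49) — NOT proved here, nor anywhere in the lane yet); NOT [B9] Thm
3.1∕3.3 as printed and no estimate of Bałaban's.  NE2⁺ NOT PRINTED; N15 of record untouched (DISCHARGED OF RECORD 8∕28 AS CONSUMED, p687738) — no re-pin, nothing re-claimed, no count
moved; K3⁸ OPEN; one finite 𝕋⁴ at fixed ε per index — NOT infinite volume ∕ OS ∕ mass gap ∕ Clay.  Restate-immune (no Theses import).  `maxHeartbeats 1600000` ×1 (191's budget).
-/


noncomputable section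

open scoped BigOperators Matrix

namespace Summit.QuantumFields.YangMills.BalabanUVNodes.N15.Gluing

open Literature.MathematicalPhysics.QuantumFieldTheory.Balaban1983to89
open Literature.MathematicalPhysics.QuantumFieldTheory.Balaban1983to89.B11SectG (BlockNorm HasMaj)
open Literature.MathematicalPhysics.QuantumFieldTheory.Balaban1983to89.B6Prop26Gluing (mulOp mulOp_apply)
open Literature.MathematicalPhysics.QuantumFieldTheory.Balaban1983to89.B6UnitTorusCarrier (unitTorusGeo unitTorusGeo_dist unitTorusGeo_dist_nonneg)
open Literature.MathematicalPhysics.QuantumFieldTheory.King1986.Torus (blockOf)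
open Literature.Barriers.QuantumFields (traceForm)
open Literature.MathematicalPhysics.QuantumFieldTheory.Balaban1983to89.Beta.AveragingCorrectionJets (adCLM)
open Summit.QuantumFields.YangMills.BalabanUVNodes.N15.BackgroundLayer (covLapM tCoefA tCoefC gavgM gaugeLetters_of_mean)
open Summit.QuantumFields.YangMills.BalabanUVNodes.N15.VectorPiece (bshiftEquiv kingPrV kingPrV_bshiftEquiv_pow fibre_conn_kingPrV bshiftEquiv_comm blkFine_comp_kingPrV)
open Summit.QuantumFields.YangMills.BalabanUVNodes.N15.MatrixSpecies (mmulOp coordMat basisConst basisConst_nonneg liftBlk liftMap)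
open Summit.QuantumFields.YangMills.BalabanUVNodes.N15.TwoGrid (chiCube abs_chiCube_le_one)
open Summit.QuantumFields.YangMills.BalabanUVNodes.N15.CurvedSpecies (gaugePair expTrField curvCoefC_one curvCoefA_one twoSidedLetters_curvCoef_one_of_meanGauge
  coordMat_adCLM_transpose_eq_neg_of_conjTranspose)
open Summit.QuantumFields.YangMills.BalabanUVNodes.N15.CovAvg (hasMaj_nvQ)
open Literature.NumberTheory.Sieve.SquarefreeSums (exp_sub_one_le_two_mul)

variable {d : ℕ}

section Pair

open scoped Matrix.Norms.L2Operator

variable {L : ℕ} [NeZero L]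

set_option maxHeartbeats 1600000 in
/-- ★★ **THE GLUED PROPAGATORS OF THE COVER AT BOTH SPACINGS WITH BAŁABAN's FULLY COVARIANT SUMMAND `P = N_L ⊗ 1 − N_V^Q − N_V^R` LIVE: block locality and the two inverse identities on
each grid, rate-capped, the Landau letter displayed** (n15-c∕191 `sfq_cvGlued_pair_spec`'s statement and proof text at `P := N_L ⊗ 1 − N_V^Q − N_V^R`, `N_V := N_V^Q + N_V^R`, over the
δ-capped FILES 120∕122 — n15-c∕208 `uN_cvGlued_spec_cap`, (t2) F1 `uN_cvGlued'_spec_cap`).  For every `δ_e > 0`: `δ ≤ δ_e`, `w₀, R₀, θ₀, R₁, B > 0` such that under n15-c∕188's hypotheses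
(skew `A′` in FILE 130's C² window at scale `r_A ≤ 1`, transporter sizes `K, K₁ ≤ 1`) and a Landau letter `ρ_R ≥ 0` with `S(1+|J⊕J|) + R₁(K+K₁) + ρ_R ≤ R₀`, `R₁(K+K₁) + ρ_R ≤ θ₀`, IF the
Landau perturbation is `≤ ρ_R·e^{−δ_e d}` on the coarse grid (`N_V^R(e^{ηĀ′})`, sharp blocks) and on the fine grid (`N_V^R′(e^{η′A′})`, blocks `cvBlk∘π̂`) — n15-c∕211's two one-grid global
rows, DISPLAYED — THEN on the coarse grid and on the fine grid the glued operator with summand `N_L ⊗ 1 − N_V^Q − N_V^R` and perturbation `N_V^Q + N_V^R` (EXACTLY the pair of n15-c∕207a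
`sfqrEntry0`) is block-local (`≤ B e^{−δd}`) and a two-sided inverse of `Δ_{Ad U} ⊗… + P`.  The `N_V^Q` rows are discharged as in 191 (187b∕182b); the `N_V^R` rows enter the near∕far cut-off
rows by sandwiching (cut-offs bounded by one).  MODEL operator ∕ class ∕ carriers; the Landau rows are HYPOTHESES; NOT any printed estimate.
[cite: Balaban1985BackgroundPropagators, (3.25)–(3.26) p.395, (3.49) p.398 (shape of the Landau rows), (3.59)–(3.60) p.402, (3.62)–(3.65) pp.402–403, (3.76)–(3.77) p.406 (mechanism); Balaban1984PropagatorsI, (1.69) p.29;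
Balaban1984PropagatorsII, (2.91) p.239, (2.133)–(2.136) p.247] -/
theorem sfqr_cvGlued_pair_spec (hL : Odd L ∧ 1 < L) (hL7 : 7 ≤ L) {a : ℝ} (ha : 0 < a) (ι : Type) [Fintype ι] [DecidableEq ι] {δe : ℝ} (hδe : 0 < δe) :
    ∃ δ w₀ R₀ θ₀ R₁ B : ℝ, 0 < δ ∧ δ ≤ δe ∧ 0 < R₀ ∧ 0 < θ₀ ∧ 0 < R₁ ∧ 0 < B ∧
      ∀ (mv kk r : ℕ), 1 ≤ kk → w₀ ≤ ((L ^ mv : ℕ) : ℝ) →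
      ∀ {mm : Type} [Fintype mm] [DecidableEq mm] (e : Matrix mm mm ℂ ≃L[ℝ] (ι → ℝ)), (∀ A B : Matrix mm mm ℂ, traceForm A B = e A ⬝ᵥ e B) →
      ∀ (A' : Fin (d + 1) → CvX' d L mv kk r hL → Matrix mm mm ℂ), (∀ μ x', (A' μ x')ᴴ = -A' μ x') →
      ∀ (rA : ℝ), 0 ≤ rA → rA ≤ 1 → (∀ μ x', ‖A' μ x'‖ ≤ rA) →
        (∀ μ κ x', ‖A' μ (bshiftEquiv (cvM d L mv kk hL) (L ^ r * L ^ kk) κ x') - A' μ x'‖ ≤ rA * ((((L ^ r * L ^ kk : ℕ) : ℝ))⁻¹)) →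
        (∀ μ κ x', ‖(A' μ (bshiftEquiv (cvM d L mv kk hL) (L ^ r * L ^ kk) κ x') - A' μ x') -
            (A' μ (bshiftEquiv (cvM d L mv kk hL) (L ^ r * L ^ kk) κ ((bshiftEquiv (cvM d L mv kk hL) (L ^ r * L ^ kk) μ).symm x')) -
              A' μ ((bshiftEquiv (cvM d L mv kk hL) (L ^ r * L ^ kk) μ).symm x'))‖ ≤ rA * ((((L ^ r * L ^ kk : ℕ) : ℝ))⁻¹) * ((((L ^ r * L ^ kk : ℕ) : ℝ))⁻¹)) →
        2 * ((1 + Fintype.card (Fin (d + 1))) * ((3 + 2 * ((d : ℝ) + 1)) * rA)) ≤ 1 →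
      ∀ (ρR : ℝ), 0 ≤ ρR →
        (14 * Real.exp 1 * (1 + Fintype.card (Fin (d + 1))) * basisConst e * ((1 + Fintype.card (Fin (d + 1))) * ((3 + 2 * ((d : ℝ) + 1)) * rA))) * (1 + Fintype.card (Fin (d + 1) ⊕ Fin (d + 1))) + R₁ * (((1 + Fintype.card ι * (@basisConst ι _ (Matrix mm mm ℂ) Matrix.frobeniusNormedAddCommGroup Matrix.frobeniusNormedSpace e * (2 * Real.sqrt (Fintype.card mm)) * (Real.sqrt (Fintype.card mm) * (2 * (rA * ((((L ^ kk : ℕ) : ℝ))⁻¹)))))) ^ ((d + 2) * L ^ kk) - 1) + ((1 + Fintype.card ι * (@basisConst ι _ (Matrix mm mm ℂ) Matrix.frobeniusNormedAddCommGroup Matrix.frobeniusNormedSpace e * (2 * Real.sqrt (Fintype.card mm)) * (Real.sqrt (Fintype.card mm) * (2 * (rA * ((((L ^ r * L ^ kk : ℕ) : ℝ))⁻¹)))))) ^ ((d + 2) * (L ^ r * L ^ kk)) - 1)) + ρR ≤ R₀ →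
        R₁ * (((1 + Fintype.card ι * (@basisConst ι _ (Matrix mm mm ℂ) Matrix.frobeniusNormedAddCommGroup Matrix.frobeniusNormedSpace e * (2 * Real.sqrt (Fintype.card mm)) * (Real.sqrt (Fintype.card mm) * (2 * (rA * ((((L ^ kk : ℕ) : ℝ))⁻¹)))))) ^ ((d + 2) * L ^ kk) - 1) + ((1 + Fintype.card ι * (@basisConst ι _ (Matrix mm mm ℂ) Matrix.frobeniusNormedAddCommGroup Matrix.frobeniusNormedSpace e * (2 * Real.sqrt (Fintype.card mm)) * (Real.sqrt (Fintype.card mm) * (2 * (rA * ((((L ^ r * L ^ kk : ℕ) : ℝ))⁻¹)))))) ^ ((d + 2) * (L ^ r * L ^ kk)) - 1)) + ρR ≤ θ₀ → ((1 + Fintype.card ι * (@basisConst ι _ (Matrix mm mm ℂ) Matrix.frobeniusNormedAddCommGroup Matrix.frobeniusNormedSpace e * (2 * Real.sqrt (Fintype.card mm)) * (Real.sqrt (Fintype.card mm) * (2 * (rA * ((((L ^ kk : ℕ) : ℝ))⁻¹)))))) ^ ((d + 2) * L ^ kk) - 1) ≤ 1 → ((1 + Fintype.card ι * (@basisConst ι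 _ (Matrix mm mm ℂ) Matrix.frobeniusNormedAddCommGroup Matrix.frobeniusNormedSpace e * (2 * Real.sqrt (Fintype.card mm)) * (Real.sqrt (Fintype.card mm) * (2 * (rA * ((((L ^ r * L ^ kk : ℕ) : ℝ))⁻¹)))))) ^ ((d + 2) * (L ^ r * L ^ kk)) - 1) ≤ 1 →
        HasMaj (CvNorm d L mv kk hL ι) (CvNorm d L mv kk hL ι) (cvNVr d L mv kk hL a ι e (fun μ x => NormedSpace.exp (((((L ^ kk : ℕ) : ℝ))⁻¹) • gavgM (Matrix mm mm ℂ) (Fin (d + 1)) (kingPrV L kk r (cvM d L mv kk hL)) A' μ x))) (fun y y' => ρR * Real.exp (-(δe * (unitTorusGeo L kk (cvM d L mv kk hL)).dist y y'))) →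
        HasMaj (BlockNorm.ofBlocks (unitTorusGeo L kk (cvM d L mv kk hL)) (liftBlk (cvBlk d L mv kk hL ∘ (kingPrV L kk r (cvM d L mv kk hL))) ι)) (BlockNorm.ofBlocks (unitTorusGeo L kk (cvM d L mv kk hL)) (liftBlk (cvBlk d L mv kk hL ∘ (kingPrV L kk r (cvM d L mv kk hL))) ι)) (cvNVr' d L mv kk r hL a ι e (fun μ x' => NormedSpace.exp (((((L ^ r * L ^ kk : ℕ) : ℝ))⁻¹) • A' μ x'))) (fun y y' => ρR * Real.exp (-(δe * (unitTorusGeo L kk (cvM d L mv kk hL)).dist y y'))) →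
        (HasMaj (CvNorm d L mv kk hL ι) (CvNorm d L mv kk hL ι) (cvGlued d L mv kk hL a ((((L ^ kk : ℕ) : ℝ))⁻¹) ι e (fun _ _ => (1 : Matrix mm mm ℂ)) (fun μ x => NormedSpace.exp (((((L ^ kk : ℕ) : ℝ))⁻¹) • gavgM (Matrix mm mm ℂ) (Fin (d + 1)) (kingPrV L kk r (cvM d L mv kk hL)) A' μ x)) (cvNL d L mv kk hL a ι - (cvNVq d L mv kk hL a ι e (fun μ x => NormedSpace.exp (((((L ^ kk : ℕ) : ℝ))⁻¹) • gavgM (Matrix mm mm ℂ) (Fin (d + 1)) (kingPrV L kk r (cvM d L mv kk hL)) A' μ x))) - (cvNVr d L mv kk hL a ι e (fun μ x => NormedSpace.exp (((((L ^ kk : ℕ) : ℝ))⁻¹) • gavgM (Matrix mm mm ℂ) (Fin (d + 1)) (kingPrV L kk r (cvM d L mv kk hL)) A' μ x)))) (fun _ => (cvNVq d L mv kk hL a ι e (fun μ x => NormedSpace.exp (((((L ^ kk : ℕ) : ℝ))⁻¹) • gavgM (Matrix mm mm ℂ) (Fin (d + 1)) (kingPrV L kk r (cvM d L mv kk hL))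 A' μ x))) + (cvNVr d L mv kk hL a ι e (fun μ x => NormedSpace.exp (((((L ^ kk : ℕ) : ℝ))⁻¹) • gavgM (Matrix mm mm ℂ) (Fin (d + 1)) (kingPrV L kk r (cvM d L mv kk hL)) A' μ x)))))
          (fun y y' => B * Real.exp (-(δ * (unitTorusGeo L kk (cvM d L mv kk hL)).dist y y'))) ∧
        (cvGlued d L mv kk hL a ((((L ^ kk : ℕ) : ℝ))⁻¹) ι e (fun _ _ => (1 : Matrix mm mm ℂ)) (fun μ x => NormedSpace.exp (((((L ^ kk : ℕ) : ℝ))⁻¹) • gavgM (Matrix mm mm ℂ) (Fin (d + 1)) (kingPrV L kk r (cvM d L mv kk hL)) A' μ x)) (cvNL d L mv kk hL a ι - (cvNVq d L mv kk hL a ι e (fun μ x => NormedSpace.exp (((((L ^ kk : ℕ) : ℝ))⁻¹) • gavgM (Matrix mm mm ℂ) (Fin (d + 1)) (kingPrV L kk r (cvM d L mv kk hL)) A' μ x))) - (cvNVr d L mv kk hL a ι e (fun μ x => NormedSpace.exp (((((L ^ kk : ℕ) : ℝ))⁻¹) • gavgM (Matrix mm mm ℂ) (Fin (d + 1)) (kingPrV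 L kk r (cvM d L mv kk hL)) A' μ x)))) (fun _ => (cvNVq d L mv kk hL a ι e (fun μ x => NormedSpace.exp (((((L ^ kk : ℕ) : ℝ))⁻¹) • gavgM (Matrix mm mm ℂ) (Fin (d + 1)) (kingPrV L kk r (cvM d L mv kk hL)) A' μ x))) + (cvNVr d L mv kk hL a ι e (fun μ x => NormedSpace.exp (((((L ^ kk : ℕ) : ℝ))⁻¹) • gavgM (Matrix mm mm ℂ) (Fin (d + 1)) (kingPrV L kk r (cvM d L mv kk hL)) A' μ x)))) ∘ₗ (covLapM (bshiftEquiv (cvM d L mv kk hL) (L ^ kk)) ((((L ^ kk : ℕ) : ℝ))⁻¹) (gaugePair (bshiftEquiv (cvM d L mv kk hL) (L ^ kk)) (fun μ x => coordMat e (ContinuousLinearMap.mulLeftRight ℝ (Matrix mm mm ℂ) (NormedSpace.exp (((((L ^ kk : ℕ) : ℝ))⁻¹) • gavgM (Matrix mm mm ℂ) (Fin (d + 1)) (kingPrV L kk r (cvM d L mv kk hL)) A' μ x)) (NormedSpace.exp (((((L ^ kk : ℕ) : ℝ))⁻¹) • gavgM (Matrix mm mm ℂ) (Fin (d + 1)) (kingPrV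 L kk r (cvM d L mv kk hL)) A' μ x))ᴴ))) + (cvNL d L mv kk hL a ι - (cvNVq d L mv kk hL a ι e (fun μ x => NormedSpace.exp (((((L ^ kk : ℕ) : ℝ))⁻¹) • gavgM (Matrix mm mm ℂ) (Fin (d + 1)) (kingPrV L kk r (cvM d L mv kk hL)) A' μ x))) - (cvNVr d L mv kk hL a ι e (fun μ x => NormedSpace.exp (((((L ^ kk : ℕ) : ℝ))⁻¹) • gavgM (Matrix mm mm ℂ) (Fin (d + 1)) (kingPrV L kk r (cvM d L mv kk hL)) A' μ x))))) = LinearMap.id ∧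
          (covLapM (bshiftEquiv (cvM d L mv kk hL) (L ^ kk)) ((((L ^ kk : ℕ) : ℝ))⁻¹) (gaugePair (bshiftEquiv (cvM d L mv kk hL) (L ^ kk)) (fun μ x => coordMat e (ContinuousLinearMap.mulLeftRight ℝ (Matrix mm mm ℂ) (NormedSpace.exp (((((L ^ kk : ℕ) : ℝ))⁻¹) • gavgM (Matrix mm mm ℂ) (Fin (d + 1)) (kingPrV L kk r (cvM d L mv kk hL)) A' μ x)) (NormedSpace.exp (((((L ^ kk : ℕ) : ℝ))⁻¹) • gavgM (Matrix mm mm ℂ) (Fin (d + 1)) (kingPrV L kk r (cvM d L mv kk hL)) A' μ x))ᴴ))) + (cvNL d L mv kk hL a ι - (cvNVq d L mv kk hL a ι e (fun μ x => NormedSpace.exp (((((L ^ kk : ℕ) : ℝ))⁻¹) • gavgM (Matrix mm mm ℂ) (Fin (d + 1)) (kingPrV L kk r (cvM d L mv kk hL)) A' μ x))) - (cvNVr d L mv kk hL a ι e (fun μ x => NormedSpace.exp (((((L ^ kk : ℕ) : ℝ))⁻¹) • gavgM (Matrix mm mm ℂ) (Fin (d + 1)) (kingPrV L kk r (cvM d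 L mv kk hL)) A' μ x))))) ∘ₗ cvGlued d L mv kk hL a ((((L ^ kk : ℕ) : ℝ))⁻¹) ι e (fun _ _ => (1 : Matrix mm mm ℂ)) (fun μ x => NormedSpace.exp (((((L ^ kk : ℕ) : ℝ))⁻¹) • gavgM (Matrix mm mm ℂ) (Fin (d + 1)) (kingPrV L kk r (cvM d L mv kk hL)) A' μ x)) (cvNL d L mv kk hL a ι - (cvNVq d L mv kk hL a ι e (fun μ x => NormedSpace.exp (((((L ^ kk : ℕ) : ℝ))⁻¹) • gavgM (Matrix mm mm ℂ) (Fin (d + 1)) (kingPrV L kk r (cvM d L mv kk hL)) A' μ x))) - (cvNVr d L mv kk hL a ι e (fun μ x => NormedSpace.exp (((((L ^ kk : ℕ) : ℝ))⁻¹) • gavgM (Matrix mm mm ℂ) (Fin (d + 1)) (kingPrV L kk r (cvM d L mv kk hL)) A' μ x)))) (fun _ => (cvNVq d L mv kk hL a ι e (fun μ x => NormedSpace.exp (((((L ^ kk : ℕ) : ℝ))⁻¹) • gavgM (Matrix mm mm ℂ) (Fin (d + 1)) (kingPrV L kk r (cvM d L mv kk hL)) A' μ x))) + (cvNVr d L mv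 kk hL a ι e (fun μ x => NormedSpace.exp (((((L ^ kk : ℕ) : ℝ))⁻¹) • gavgM (Matrix mm mm ℂ) (Fin (d + 1)) (kingPrV L kk r (cvM d L mv kk hL)) A' μ x)))) = LinearMap.id) ) ∧
        (HasMaj (BlockNorm.ofBlocks (unitTorusGeo L kk (cvM d L mv kk hL)) (liftBlk (fun b : CvX' d L mv kk r hL => blockOf (L ^ r * L ^ kk) (cvM d L mv kk hL) b.1) ι)) (BlockNorm.ofBlocks (unitTorusGeo L kk (cvM d L mv kk hL)) (liftBlk (fun b : CvX' d L mv kk r hL => blockOf (L ^ r * L ^ kk) (cvM d L mv kk hL) b.1) ι)) (cvGlued' d L mv kk r hL a ((((L ^ r * L ^ kk : ℕ) : ℝ))⁻¹) ι e (fun _ _ => (1 : Matrix mm mm ℂ)) (fun μ x' => NormedSpace.exp (((((L ^ r * L ^ kk : ℕ) : ℝ))⁻¹) • A' μ x')) (cvNL' d L mv kk r hL a ι - (cvNVq' d L mv kk r hL a ι e (fun μ x' => NormedSpace.exp (((((L ^ r * L ^ kk : ℕ) : ℝ))⁻¹) • A' μ x'))) - (cvNVr' d L mv kk r hL a ι e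 (fun μ x' => NormedSpace.exp (((((L ^ r * L ^ kk : ℕ) : ℝ))⁻¹) • A' μ x')))) (fun _ => (cvNVq' d L mv kk r hL a ι e (fun μ x' => NormedSpace.exp (((((L ^ r * L ^ kk : ℕ) : ℝ))⁻¹) • A' μ x'))) + (cvNVr' d L mv kk r hL a ι e (fun μ x' => NormedSpace.exp (((((L ^ r * L ^ kk : ℕ) : ℝ))⁻¹) • A' μ x')))))
          (fun y y' => B * Real.exp (-(δ * (unitTorusGeo L kk (cvM d L mv kk hL)).dist y y'))) ∧
        (cvGlued' d L mv kk r hL a ((((L ^ r * L ^ kk : ℕ) : ℝ))⁻¹) ι e (fun _ _ => (1 : Matrix mm mm ℂ)) (fun μ x' => NormedSpace.exp (((((L ^ r * L ^ kk : ℕ) : ℝ))⁻¹) • A' μ x')) (cvNL' d L mv kk r hL a ι - (cvNVq' d L mv kk r hL a ι e (fun μ x' => NormedSpace.exp (((((L ^ r * L ^ kk : ℕ) : ℝ))⁻¹) • A' μ x'))) - (cvNVr' d L mv kk r hL a ι e (fun μ x' => NormedSpace.exp (((((L ^ r * L ^ kk : ℕ) : ℝ))⁻¹) • A' μ x'))))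 (fun _ => (cvNVq' d L mv kk r hL a ι e (fun μ x' => NormedSpace.exp (((((L ^ r * L ^ kk : ℕ) : ℝ))⁻¹) • A' μ x'))) + (cvNVr' d L mv kk r hL a ι e (fun μ x' => NormedSpace.exp (((((L ^ r * L ^ kk : ℕ) : ℝ))⁻¹) • A' μ x')))) ∘ₗ (covLapM (bshiftEquiv (cvM d L mv kk hL) (L ^ r * L ^ kk)) ((((L ^ r * L ^ kk : ℕ) : ℝ))⁻¹) (gaugePair (bshiftEquiv (cvM d L mv kk hL) (L ^ r * L ^ kk)) (fun μ x' => coordMat e (ContinuousLinearMap.mulLeftRight ℝ (Matrix mm mm ℂ) (NormedSpace.exp (((((L ^ r * L ^ kk : ℕ) : ℝ))⁻¹) • A' μ x')) (NormedSpace.exp (((((L ^ r * L ^ kk : ℕ) : ℝ))⁻¹) • A' μ x'))ᴴ))) + (cvNL' d L mv kk r hL a ι - (cvNVq' d L mv kk r hL a ι e (fun μ x' => NormedSpace.exp (((((L ^ r * L ^ kk : ℕ) : ℝ))⁻¹) • A' μ x'))) - (cvNVr' d L mv kk r hL a ι e (fun μ x' => NormedSpace.exp (((((L ^ r * L ^ kk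 : ℕ) : ℝ))⁻¹) • A' μ x'))))) = LinearMap.id ∧
          (covLapM (bshiftEquiv (cvM d L mv kk hL) (L ^ r * L ^ kk)) ((((L ^ r * L ^ kk : ℕ) : ℝ))⁻¹) (gaugePair (bshiftEquiv (cvM d L mv kk hL) (L ^ r * L ^ kk)) (fun μ x' => coordMat e (ContinuousLinearMap.mulLeftRight ℝ (Matrix mm mm ℂ) (NormedSpace.exp (((((L ^ r * L ^ kk : ℕ) : ℝ))⁻¹) • A' μ x')) (NormedSpace.exp (((((L ^ r * L ^ kk : ℕ) : ℝ))⁻¹) • A' μ x'))ᴴ))) + (cvNL' d L mv kk r hL a ι - (cvNVq' d L mv kk r hL a ι e (fun μ x' => NormedSpace.exp (((((L ^ r * L ^ kk : ℕ) : ℝ))⁻¹) • A' μ x'))) - (cvNVr' d L mv kk r hL a ι e (fun μ x' => NormedSpace.exp (((((L ^ r * L ^ kk : ℕ) : ℝ))⁻¹) • A' μ x'))))) ∘ₗ cvGlued' d L mv kk r hL a ((((L ^ r * L ^ kk : ℕ) : ℝ))⁻¹) ι e (fun _ _ => (1 : Matrix mm mm ℂ)) (fun μ x' => NormedSpace.exp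 (((((L ^ r * L ^ kk : ℕ) : ℝ))⁻¹) • A' μ x')) (cvNL' d L mv kk r hL a ι - (cvNVq' d L mv kk r hL a ι e (fun μ x' => NormedSpace.exp (((((L ^ r * L ^ kk : ℕ) : ℝ))⁻¹) • A' μ x'))) - (cvNVr' d L mv kk r hL a ι e (fun μ x' => NormedSpace.exp (((((L ^ r * L ^ kk : ℕ) : ℝ))⁻¹) • A' μ x')))) (fun _ => (cvNVq' d L mv kk r hL a ι e (fun μ x' => NormedSpace.exp (((((L ^ r * L ^ kk : ℕ) : ℝ))⁻¹) • A' μ x'))) + (cvNVr' d L mv kk r hL a ι e (fun μ x' => NormedSpace.exp (((((L ^ r * L ^ kk : ℕ) : ℝ))⁻¹) • A' μ x')))) = LinearMap.id) ) := by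
  have hLpos : 0 < L := Nat.pos_of_ne_zero (NeZero.ne L)
  obtain ⟨δ₁, w₁, R₁', θ₁, B₁, hδ₁, hδ₁e, hR₁', hθ₁, hB₁, H₁⟩ := uN_cvGlued_spec_cap (d := d) hL hL7 ha ι hδe
  obtain ⟨δ₂, w₂, R₂, θ₂, B₂, hδ₂, hδ₂e, hR₂, hθ₂, hB₂, H₂⟩ := uN_cvGlued'_spec_cap (d := d) hL hL7 ha ι hδe
  have hc10 : 0 ≤ B4Sect5Proof.latticeConst (d + 1) δ₁ := B4Sect5Proof.latticeConst_nonneg (d + 1) hδ₁.le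
  have hc20 : 0 ≤ B4Sect5Proof.latticeConst (d + 1) δ₂ := B4Sect5Proof.latticeConst_nonneg (d + 1) hδ₂.le
  refine ⟨min (δ₁ / 16) (δ₂ / 16), max w₁ w₂, min R₁' R₂, min θ₁ θ₂, 3 * |a| * ((B4Sect5Proof.latticeConst (d + 1) δ₁ * Real.exp (3 * δ₁)) + (B4Sect5Proof.latticeConst (d + 1) δ₂ * Real.exp (3 * δ₂))) + 1, max B₁ B₂, lt_min (by positivity) (by positivity),
    ((min_le_left _ _).trans (by linarith only [hδ₁e, hδ₁])), lt_min hR₁' hR₂, lt_min hθ₁ hθ₂,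
    by positivity, lt_max_of_lt_left hB₁, fun mv kk r hk hw₀ => ?_⟩
  set Rq : ℝ := 3 * |a| * ((B4Sect5Proof.latticeConst (d + 1) δ₁ * Real.exp (3 * δ₁)) + (B4Sect5Proof.latticeConst (d + 1) δ₂ * Real.exp (3 * δ₂))) + 1 with hRqdef
  intro mm _ _ e he A' hA' rA hrA hrA1 h1 h2 h3 hr2 ρR hρR hRle hθle hKc hKf hGr hGr'
  have hw₁ : w₁ ≤ ((L ^ mv : ℕ) : ℝ) := (le_max_left _ _).trans hw₀
  have hw₂ : w₂ ≤ ((L ^ mv : ℕ) : ℝ) := (le_max_right _ _).trans hw₀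
  -- the two spacings
  have hkpos : (0 : ℝ) < ((L ^ kk : ℕ) : ℝ) := Nat.cast_pos.mpr (pow_pos hLpos kk)
  have hrkpos : (0 : ℝ) < ((L ^ r * L ^ kk : ℕ) : ℝ) := Nat.cast_pos.mpr (Nat.mul_pos (pow_pos hLpos r) (pow_pos hLpos kk))
  have hη : (0 : ℝ) < ((((L ^ kk : ℕ) : ℝ))⁻¹) := inv_pos.mpr hkpos
  have hη' : (0 : ℝ) < ((((L ^ r * L ^ kk : ℕ) : ℝ))⁻¹) := inv_pos.mpr hrkpos
  have hN : ((((L ^ kk : ℕ) : ℝ))⁻¹) = ((L ^ r : ℕ) : ℝ) * ((((L ^ r * L ^ kk : ℕ) : ℝ))⁻¹) := by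
    have hr0 : ((L ^ r : ℕ) : ℝ) ≠ 0 := Nat.cast_ne_zero.mpr (pow_ne_zero _ (NeZero.ne L))
    rw [Nat.cast_mul]; field_simp
  have hη1 : ((((L ^ kk : ℕ) : ℝ))⁻¹) ≤ 1 := inv_le_one_of_one_le₀ (by exact_mod_cast Nat.one_le_pow kk L hLpos)
  have hη'1 : ((((L ^ r * L ^ kk : ℕ) : ℝ))⁻¹) ≤ 1 := inv_le_one_of_one_le₀ (by exact_mod_cast Nat.mul_pos (Nat.one_le_pow r L hLpos) (Nat.one_le_pow kk L hLpos))
  have hC₀ : (0 : ℝ) ≤ 2 * ((d : ℝ) + 1) := by positivity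
  have hCθ : (((2 * ((d + 1) * (L ^ r - 1)) : ℕ) : ℝ)) * ((((L ^ r * L ^ kk : ℕ) : ℝ))⁻¹) ≤ 2 * ((d : ℝ) + 1) * ((((L ^ kk : ℕ) : ℝ))⁻¹) := by
    have hsub : (((L ^ r - 1 : ℕ)) : ℝ) ≤ ((L ^ r : ℕ) : ℝ) := by exact_mod_cast Nat.sub_le _ _
    have hcast : (((2 * ((d + 1) * (L ^ r - 1)) : ℕ) : ℝ)) = 2 * ((d : ℝ) + 1) * (((L ^ r - 1 : ℕ)) : ℝ) := by push_cast; ring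
    rw [hcast, hN]
    calc 2 * ((d : ℝ) + 1) * (((L ^ r - 1 : ℕ)) : ℝ) * ((((L ^ r * L ^ kk : ℕ) : ℝ))⁻¹) ≤ 2 * ((d : ℝ) + 1) * ((L ^ r : ℕ) : ℝ) * ((((L ^ r * L ^ kk : ℕ) : ℝ))⁻¹) :=
          mul_le_mul_of_nonneg_right (mul_le_mul_of_nonneg_left hsub hC₀) hη'.le
      _ = 2 * ((d : ℝ) + 1) * (((L ^ r : ℕ) : ℝ) * ((((L ^ r * L ^ kk : ℕ) : ℝ))⁻¹)) := by ring
  -- King's pairing geometry and skewness in coordinates; the sup of the block mean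
  have hcomm := fun μ κ (x : CvX' d L mv kk r hL) => bshiftEquiv_comm (cvM d L mv kk hL) (L ^ r * L ^ kk) μ κ x
  have hconn := fun (f : CvX' d L mv kk r hL → Matrix mm mm ℂ) (β : ℝ)
      (hf : ∀ κ x, ‖f (bshiftEquiv (cvM d L mv kk hL) (L ^ r * L ^ kk) κ x) - f x‖ ≤ β) => fibre_conn_kingPrV L kk r (cvM d L mv kk hL) f β hf
  have hblk := fun μ (x' : CvX' d L mv kk r hL) => kingPrV_bshiftEquiv_pow L kk r (cvM d L mv kk hL) μ x'
  have hAm : ∀ μ x, (gavgM (Matrix mm mm ℂ) (Fin (d + 1)) (kingPrV L kk r (cvM d L mv kk hL)) A' μ x)ᴴ = -gavgM (Matrix mm mm ℂ) (Fin (d + 1)) (kingPrV L kk r (cvM d L mv kk hL)) A' μ x := gavgM_conjTranspose_of_skew (kingPrV L kk r (cvM d L mv kk hL)) hA'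
  have hA'c := fun μ x' => coordMat_adCLM_transpose_eq_neg_of_conjTranspose e he (hA' μ x')
  have hAmc := fun μ x => coordMat_adCLM_transpose_eq_neg_of_conjTranspose e he (hAm μ x)
  obtain ⟨g1, -, -, -, -, -⟩ := gaugeLetters_of_mean (π := (kingPrV L kk r (cvM d L mv kk hL))) (s := bshiftEquiv (cvM d L mv kk hL) (L ^ kk))
    (s' := bshiftEquiv (cvM d L mv kk hL) (L ^ r * L ^ kk)) (N := L ^ r) (Cπ := (((2 * ((d + 1) * (L ^ r - 1)) : ℕ) : ℝ))) hcomm hconn hblk hη' hN hη hrA h1 h2 h3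
  obtain ⟨hc, hcA, hc', hcA', -, -, -, -, -, -, -, -, -, -, -⟩ :=
    twoSidedLetters_curvCoef_one_of_meanGauge e (π := (kingPrV L kk r (cvM d L mv kk hL))) (s := bshiftEquiv (cvM d L mv kk hL) (L ^ kk))
      (s' := bshiftEquiv (cvM d L mv kk hL) (L ^ r * L ^ kk)) (N := L ^ r) (θ := ((((L ^ kk : ℕ) : ℝ))⁻¹)) (Cπ := (((2 * ((d + 1) * (L ^ r - 1)) : ℕ) : ℝ))) (C₀ := 2 * ((d : ℝ) + 1))
      hcomm hconn hblk hη' hN hη hη1 le_rfl hC₀ hCθ hrA hr2 hA'c hAmc h1 h2 h3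
  have hce : ∀ {X : Type} (η : ℝ) {A : Fin (d + 1) → X → Matrix mm mm ℂ}, (∀ μ x, (A μ x)ᴴ = -A μ x) →
      (fun μ x => coordMat e (ContinuousLinearMap.mulLeftRight ℝ (Matrix mm mm ℂ) ((1 : Matrix mm mm ℂ) * NormedSpace.exp (η • A μ x) * (1 : Matrix mm mm ℂ)ᴴ)
        ((1 : Matrix mm mm ℂ) * NormedSpace.exp (η • A μ x) * (1 : Matrix mm mm ℂ)ᴴ)ᴴ)) = expTrField e η (fun μ x => adCLM ℝ (A μ x)) :=
    fun η _ hA => conj_one_exp_eq_expTrField e η hA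
  rw [curvCoefC_one, curvCoefA_one, ← hce ((((L ^ kk : ℕ) : ℝ))⁻¹) hAm] at hc hcA
  rw [curvCoefC_one, curvCoefA_one, ← hce ((((L ^ r * L ^ kk : ℕ) : ℝ))⁻¹) hA'] at hc' hcA'
  have hκ0 : 0 ≤ basisConst e := basisConst_nonneg e
  have hκF := @basisConst_nonneg ι _ (Matrix mm mm ℂ) Matrix.frobeniusNormedAddCommGroup Matrix.frobeniusNormedSpace e
  have hS0 : 0 ≤ (14 * Real.exp 1 * (1 + Fintype.card (Fin (d + 1))) * basisConst e * ((1 + Fintype.card (Fin (d + 1))) * ((3 + 2 * ((d : ℝ) + 1)) * rA))) := by positivity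
  -- the cuts
  have hχ1 : ∀ (k : Fin (d + 1) → ZMod (2 * L)) (x : CvX d L mv kk hL), |cvChi d L mv kk hL k x| ≤ 1 := fun k x => abs_chiCube_le_one _ x
  have hψ1 : ∀ (k : Fin (d + 1) → ZMod (2 * L)) (x : CvX d L mv kk hL), |cvPsi d L mv kk hL k x| ≤ 1 := fun k x => abs_chiCube_le_one _ x
  have hχ1' : ∀ (k : Fin (d + 1) → ZMod (2 * L)) (x' : CvX' d L mv kk r hL), |cvChi' d L mv kk r hL k x'| ≤ 1 := fun k x' => abs_chiCube_le_one _ x'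
  have hψ1' : ∀ (k : Fin (d + 1) → ZMod (2 * L)) (x' : CvX' d L mv kk r hL), |cvPsi' d L mv kk r hL k x'| ≤ 1 := fun k x' => abs_chiCube_le_one _ x'
  have h1ψ : ∀ (k : Fin (d + 1) → ZMod (2 * L)) (x : CvX d L mv kk hL), |(1 - cvPsi d L mv kk hL k) x| ≤ 1 := fun k x => by
    rw [Pi.sub_apply, Pi.one_apply]; unfold cvPsi chiCube; split_ifs <;> simp
  have h1ψ' : ∀ (k : Fin (d + 1) → ZMod (2 * L)) (x' : CvX' d L mv kk r hL), |(1 - cvPsi' d L mv kk r hL k) x'| ≤ 1 := fun k x' => by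
    rw [Pi.sub_apply, Pi.one_apply]; unfold cvPsi' chiCube; split_ifs <;> simp
  have hid : ∀ k : Fin (d + 1) → ZMod (2 * L), (LinearMap.id - mulOp (fun p : CvX d L mv kk hL × ι => cvPsi d L mv kk hL k p.1)) =
      mulOp (fun p : CvX d L mv kk hL × ι => (1 - cvPsi d L mv kk hL k) p.1) := fun k =>
    LinearMap.ext fun f => funext fun p => by simp [mulOp_apply, sub_mul]
  have hid' : ∀ k : Fin (d + 1) → ZMod (2 * L), (LinearMap.id - mulOp (fun p : CvX' d L mv kk r hL × ι => cvPsi' d L mv kk r hL k p.1)) =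
      mulOp (fun p : CvX' d L mv kk r hL × ι => (1 - cvPsi' d L mv kk r hL k) p.1) := fun k =>
    LinearMap.ext fun f => funext fun p => by simp [mulOp_apply, sub_mul]
  -- (P-Q) the transporter letters of `e^{ηĀ′}`, `e^{η′A′}`
  have hexpc : Real.exp (((((L ^ kk : ℕ) : ℝ))⁻¹) * rA) - 1 ≤ 2 * (rA * ((((L ^ kk : ℕ) : ℝ))⁻¹)) := by
    have h := exp_sub_one_le_two_mul (x := ((((L ^ kk : ℕ) : ℝ))⁻¹) * rA) (by positivity) (mul_le_one₀ hη1 hrA hrA1); linarith [mul_comm ((((L ^ kk : ℕ) : ℝ))⁻¹) rA]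
  have hexpf : Real.exp (((((L ^ r * L ^ kk : ℕ) : ℝ))⁻¹) * rA) - 1 ≤ 2 * (rA * ((((L ^ r * L ^ kk : ℕ) : ℝ))⁻¹)) := by
    have h := exp_sub_one_le_two_mul (x := ((((L ^ r * L ^ kk : ℕ) : ℝ))⁻¹) * rA) (by positivity) (mul_le_one₀ hη'1 hrA hrA1); linarith [mul_comm ((((L ^ r * L ^ kk : ℕ) : ℝ))⁻¹) rA]
  have hTr : ∀ μ p i, ∑ j, |(cvT e (fun μ x => NormedSpace.exp (((((L ^ kk : ℕ) : ℝ))⁻¹) • gavgM (Matrix mm mm ℂ) (Fin (d + 1)) (kingPrV L kk r (cvM d L mv kk hL)) A' μ x)) μ p - 1) i j| ≤ Fintype.card ι * (@basisConst ι _ (Matrix mm mm ℂ) Matrix.frobeniusNormedAddCommGroup Matrix.frobeniusNormedSpace e * (2 * Real.sqrt (Fintype.card mm)) * (Real.sqrt (Fintype.card mm) * (2 * (rA * ((((L ^ kk : ℕ) : ℝ))⁻¹))))) := fun μ p i =>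
    (sf_rows_cvT_exp_sub_one_le e hη.le hAm g1 μ p i).trans (by gcongr)
  have hTc : ∀ μ p j, ∑ i, |(cvT e (fun μ x => NormedSpace.exp (((((L ^ kk : ℕ) : ℝ))⁻¹) • gavgM (Matrix mm mm ℂ) (Fin (d + 1)) (kingPrV L kk r (cvM d L mv kk hL)) A' μ x)) μ p - 1) i j| ≤ Fintype.card ι * (@basisConst ι _ (Matrix mm mm ℂ) Matrix.frobeniusNormedAddCommGroup Matrix.frobeniusNormedSpace e * (2 * Real.sqrt (Fintype.card mm)) * (Real.sqrt (Fintype.card mm) * (2 * (rA * ((((L ^ kk : ℕ) : ℝ))⁻¹))))) := fun μ p j =>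
    (sf_cols_cvT_exp_sub_one_le e hη.le hAm g1 μ p j).trans (by gcongr)
  have hTr' : ∀ μ p i, ∑ j, |(cvT e (fun μ x' => NormedSpace.exp (((((L ^ r * L ^ kk : ℕ) : ℝ))⁻¹) • A' μ x')) μ p - 1) i j| ≤ Fintype.card ι * (@basisConst ι _ (Matrix mm mm ℂ) Matrix.frobeniusNormedAddCommGroup Matrix.frobeniusNormedSpace e * (2 * Real.sqrt (Fintype.card mm)) * (Real.sqrt (Fintype.card mm) * (2 * (rA * ((((L ^ r * L ^ kk : ℕ) : ℝ))⁻¹))))) := fun μ p i =>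
    (sf_rows_cvT_exp_sub_one_le e hη'.le hA' h1 μ p i).trans (by gcongr)
  have hTc' : ∀ μ p j, ∑ i, |(cvT e (fun μ x' => NormedSpace.exp (((((L ^ r * L ^ kk : ℕ) : ℝ))⁻¹) • A' μ x')) μ p - 1) i j| ≤ Fintype.card ι * (@basisConst ι _ (Matrix mm mm ℂ) Matrix.frobeniusNormedAddCommGroup Matrix.frobeniusNormedSpace e * (2 * Real.sqrt (Fintype.card mm)) * (Real.sqrt (Fintype.card mm) * (2 * (rA * ((((L ^ r * L ^ kk : ℕ) : ℝ))⁻¹))))) := fun μ p j =>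
    (sf_cols_cvT_exp_sub_one_le e hη'.le hA' h1 μ p j).trans (by gcongr)
  have hρc0 : 0 ≤ Fintype.card ι * (@basisConst ι _ (Matrix mm mm ℂ) Matrix.frobeniusNormedAddCommGroup Matrix.frobeniusNormedSpace e * (2 * Real.sqrt (Fintype.card mm)) * (Real.sqrt (Fintype.card mm) * (2 * (rA * ((((L ^ kk : ℕ) : ℝ))⁻¹))))) := by positivity
  have hρf0 : 0 ≤ Fintype.card ι * (@basisConst ι _ (Matrix mm mm ℂ) Matrix.frobeniusNormedAddCommGroup Matrix.frobeniusNormedSpace e * (2 * Real.sqrt (Fintype.card mm)) * (Real.sqrt (Fintype.card mm) * (2 * (rA * ((((L ^ r * L ^ kk : ℕ) : ℝ))⁻¹))))) := by positivity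
  -- (P-Q) the constants against `R₁(K + K₁)`
  have hce1 : 0 ≤ (B4Sect5Proof.latticeConst (d + 1) δ₁ * Real.exp (3 * δ₁)) := mul_nonneg hc10 (Real.exp_nonneg _)
  have hce2 : 0 ≤ (B4Sect5Proof.latticeConst (d + 1) δ₂ * Real.exp (3 * δ₂)) := mul_nonneg hc20 (Real.exp_nonneg _)
  have hRq0 : 0 ≤ Rq := by rw [hRqdef]; positivity
  have hKC0 : 0 ≤ ((1 + Fintype.card ι * (@basisConst ι _ (Matrix mm mm ℂ) Matrix.frobeniusNormedAddCommGroup Matrix.frobeniusNormedSpace e * (2 * Real.sqrt (Fintype.card mm)) * (Real.sqrt (Fintype.card mm) * (2 * (rA * ((((L ^ kk : ℕ) : ℝ))⁻¹)))))) ^ ((d + 2) * L ^ kk) - 1) := by have := one_le_pow₀ (M₀ := ℝ) (a := 1 + Fintype.card ι * (@basisConst ι _ (Matrix mm mm ℂ) Matrix.frobeniusNormedAddCommGroup Matrix.frobeniusNormedSpace e * (2 * Real.sqrt (Fintype.card mm)) * (Real.sqrt (Fintype.card mm) * (2 * (rA * ((((L ^ kk : ℕ) : ℝ))⁻¹))))))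 (by linarith) (n := (d + 2) * L ^ kk); linarith
  have hKF0 : 0 ≤ ((1 + Fintype.card ι * (@basisConst ι _ (Matrix mm mm ℂ) Matrix.frobeniusNormedAddCommGroup Matrix.frobeniusNormedSpace e * (2 * Real.sqrt (Fintype.card mm)) * (Real.sqrt (Fintype.card mm) * (2 * (rA * ((((L ^ r * L ^ kk : ℕ) : ℝ))⁻¹)))))) ^ ((d + 2) * (L ^ r * L ^ kk)) - 1) := by have := one_le_pow₀ (M₀ := ℝ) (a := 1 + Fintype.card ι * (@basisConst ι _ (Matrix mm mm ℂ) Matrix.frobeniusNormedAddCommGroup Matrix.frobeniusNormedSpace e * (2 * Real.sqrt (Fintype.card mm)) * (Real.sqrt (Fintype.card mm) * (2 * (rA * ((((L ^ r * L ^ kk : ℕ) : ℝ))⁻¹)))))) (by linarith) (n := (d + 2) * (L ^ r * L ^ kk)); linarith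
  have hconstC : |a| * (((1 + Fintype.card ι * (@basisConst ι _ (Matrix mm mm ℂ) Matrix.frobeniusNormedAddCommGroup Matrix.frobeniusNormedSpace e * (2 * Real.sqrt (Fintype.card mm)) * (Real.sqrt (Fintype.card mm) * (2 * (rA * ((((L ^ kk : ℕ) : ℝ))⁻¹)))))) ^ ((d + 2) * L ^ kk) - 1) * (2 + ((1 + Fintype.card ι * (@basisConst ι _ (Matrix mm mm ℂ) Matrix.frobeniusNormedAddCommGroup Matrix.frobeniusNormedSpace e * (2 * Real.sqrt (Fintype.card mm)) * (Real.sqrt (Fintype.card mm) * (2 * (rA * ((((L ^ kk : ℕ) : ℝ))⁻¹)))))) ^ ((d + 2) * L ^ kk) - 1)) * (B4Sect5Proof.latticeConst (d + 1) δ₁ * Real.exp (3 * δ₁))) ≤ Rq * (((1 + Fintype.card ι * (@basisConst ι _ (Matrix mm mm ℂ) Matrix.frobeniusNormedAddCommGroup Matrix.frobeniusNormedSpace e * (2 * Real.sqrt (Fintype.card mm)) * (Real.sqrt (Fintype.card mm) * (2 * (rA * ((((L ^ kk : ℕ) : ℝ))⁻¹)))))) ^ ((d + 2) * L ^ kk)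 - 1) + ((1 + Fintype.card ι * (@basisConst ι _ (Matrix mm mm ℂ) Matrix.frobeniusNormedAddCommGroup Matrix.frobeniusNormedSpace e * (2 * Real.sqrt (Fintype.card mm)) * (Real.sqrt (Fintype.card mm) * (2 * (rA * ((((L ^ r * L ^ kk : ℕ) : ℝ))⁻¹)))))) ^ ((d + 2) * (L ^ r * L ^ kk)) - 1)) := by
    have h3 : ((1 + Fintype.card ι * (@basisConst ι _ (Matrix mm mm ℂ) Matrix.frobeniusNormedAddCommGroup Matrix.frobeniusNormedSpace e * (2 * Real.sqrt (Fintype.card mm)) * (Real.sqrt (Fintype.card mm) * (2 * (rA * ((((L ^ kk : ℕ) : ℝ))⁻¹)))))) ^ ((d + 2) * L ^ kk) - 1) * (2 + ((1 + Fintype.card ι * (@basisConst ι _ (Matrix mm mm ℂ) Matrix.frobeniusNormedAddCommGroup Matrix.frobeniusNormedSpace e * (2 * Real.sqrt (Fintype.card mm)) * (Real.sqrt (Fintype.card mm) * (2 * (rA * ((((L ^ kk : ℕ) : ℝ))⁻¹)))))) ^ ((d + 2) * L ^ kk) - 1)) ≤ 3 * ((1 + Fintype.card ι * (@basisConst ι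 _ (Matrix mm mm ℂ) Matrix.frobeniusNormedAddCommGroup Matrix.frobeniusNormedSpace e * (2 * Real.sqrt (Fintype.card mm)) * (Real.sqrt (Fintype.card mm) * (2 * (rA * ((((L ^ kk : ℕ) : ℝ))⁻¹)))))) ^ ((d + 2) * L ^ kk) - 1) := by nlinarith
    calc |a| * (((1 + Fintype.card ι * (@basisConst ι _ (Matrix mm mm ℂ) Matrix.frobeniusNormedAddCommGroup Matrix.frobeniusNormedSpace e * (2 * Real.sqrt (Fintype.card mm)) * (Real.sqrt (Fintype.card mm) * (2 * (rA * ((((L ^ kk : ℕ) : ℝ))⁻¹)))))) ^ ((d + 2) * L ^ kk) - 1) * (2 + ((1 + Fintype.card ι * (@basisConst ι _ (Matrix mm mm ℂ) Matrix.frobeniusNormedAddCommGroup Matrix.frobeniusNormedSpace e * (2 * Real.sqrt (Fintype.card mm)) * (Real.sqrt (Fintype.card mm) * (2 * (rA * ((((L ^ kk : ℕ) : ℝ))⁻¹)))))) ^ ((d + 2) * L ^ kk) - 1)) * (B4Sect5Proof.latticeConst (d + 1) δ₁ * Real.exp (3 * δ₁))) ≤ |a| * (3 * ((1 + Fintype.card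 ι * (@basisConst ι _ (Matrix mm mm ℂ) Matrix.frobeniusNormedAddCommGroup Matrix.frobeniusNormedSpace e * (2 * Real.sqrt (Fintype.card mm)) * (Real.sqrt (Fintype.card mm) * (2 * (rA * ((((L ^ kk : ℕ) : ℝ))⁻¹)))))) ^ ((d + 2) * L ^ kk) - 1) * (B4Sect5Proof.latticeConst (d + 1) δ₁ * Real.exp (3 * δ₁))) := by gcongr
      _ = 3 * |a| * (B4Sect5Proof.latticeConst (d + 1) δ₁ * Real.exp (3 * δ₁)) * ((1 + Fintype.card ι * (@basisConst ι _ (Matrix mm mm ℂ) Matrix.frobeniusNormedAddCommGroup Matrix.frobeniusNormedSpace e * (2 * Real.sqrt (Fintype.card mm)) * (Real.sqrt (Fintype.card mm) * (2 * (rA * ((((L ^ kk : ℕ) : ℝ))⁻¹)))))) ^ ((d + 2) * L ^ kk) - 1) := by ring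
      _ ≤ Rq * ((1 + Fintype.card ι * (@basisConst ι _ (Matrix mm mm ℂ) Matrix.frobeniusNormedAddCommGroup Matrix.frobeniusNormedSpace e * (2 * Real.sqrt (Fintype.card mm)) * (Real.sqrt (Fintype.card mm) * (2 * (rA * ((((L ^ kk : ℕ) : ℝ))⁻¹)))))) ^ ((d + 2) * L ^ kk) - 1) := mul_le_mul_of_nonneg_right (by rw [hRqdef]; nlinarith [mul_nonneg (abs_nonneg a) hce2]) hKC0
      _ ≤ Rq * (((1 + Fintype.card ι * (@basisConst ι _ (Matrix mm mm ℂ) Matrix.frobeniusNormedAddCommGroup Matrix.frobeniusNormedSpace e * (2 * Real.sqrt (Fintype.card mm)) * (Real.sqrt (Fintype.card mm) * (2 * (rA * ((((L ^ kk : ℕ) : ℝ))⁻¹)))))) ^ ((d + 2) * L ^ kk) - 1) + ((1 + Fintype.card ι * (@basisConst ι _ (Matrix mm mm ℂ) Matrix.frobeniusNormedAddCommGroup Matrix.frobeniusNormedSpace e * (2 * Real.sqrt (Fintype.card mm)) * (Real.sqrt (Fintype.card mm) * (2 * (rA * ((((L ^ r * L ^ kk : ℕ) : ℝ))⁻¹))))))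 ^ ((d + 2) * (L ^ r * L ^ kk)) - 1)) := mul_le_mul_of_nonneg_left (le_add_of_nonneg_right hKF0) hRq0
  have hconstF : |a| * (((1 + Fintype.card ι * (@basisConst ι _ (Matrix mm mm ℂ) Matrix.frobeniusNormedAddCommGroup Matrix.frobeniusNormedSpace e * (2 * Real.sqrt (Fintype.card mm)) * (Real.sqrt (Fintype.card mm) * (2 * (rA * ((((L ^ r * L ^ kk : ℕ) : ℝ))⁻¹)))))) ^ ((d + 2) * (L ^ r * L ^ kk)) - 1) * (2 + ((1 + Fintype.card ι * (@basisConst ι _ (Matrix mm mm ℂ) Matrix.frobeniusNormedAddCommGroup Matrix.frobeniusNormedSpace e * (2 * Real.sqrt (Fintype.card mm)) * (Real.sqrt (Fintype.card mm) * (2 * (rA * ((((L ^ r * L ^ kk : ℕ) : ℝ))⁻¹)))))) ^ ((d + 2) * (L ^ r * L ^ kk)) - 1)) * (B4Sect5Proof.latticeConst (d + 1) δ₂ * Real.exp (3 * δ₂))) ≤ Rq * (((1 + Fintype.card ι * (@basisConst ι _ (Matrix mm mm ℂ) Matrix.frobeniusNormedAddCommGroup Matrix.frobeniusNormedSpace e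 * (2 * Real.sqrt (Fintype.card mm)) * (Real.sqrt (Fintype.card mm) * (2 * (rA * ((((L ^ kk : ℕ) : ℝ))⁻¹)))))) ^ ((d + 2) * L ^ kk) - 1) + ((1 + Fintype.card ι * (@basisConst ι _ (Matrix mm mm ℂ) Matrix.frobeniusNormedAddCommGroup Matrix.frobeniusNormedSpace e * (2 * Real.sqrt (Fintype.card mm)) * (Real.sqrt (Fintype.card mm) * (2 * (rA * ((((L ^ r * L ^ kk : ℕ) : ℝ))⁻¹)))))) ^ ((d + 2) * (L ^ r * L ^ kk)) - 1)) := by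
    have h3 : ((1 + Fintype.card ι * (@basisConst ι _ (Matrix mm mm ℂ) Matrix.frobeniusNormedAddCommGroup Matrix.frobeniusNormedSpace e * (2 * Real.sqrt (Fintype.card mm)) * (Real.sqrt (Fintype.card mm) * (2 * (rA * ((((L ^ r * L ^ kk : ℕ) : ℝ))⁻¹)))))) ^ ((d + 2) * (L ^ r * L ^ kk)) - 1) * (2 + ((1 + Fintype.card ι * (@basisConst ι _ (Matrix mm mm ℂ) Matrix.frobeniusNormedAddCommGroup Matrix.frobeniusNormedSpace e * (2 * Real.sqrt (Fintype.card mm)) * (Real.sqrt (Fintype.card mm) * (2 * (rA * ((((L ^ r * L ^ kk : ℕ) : ℝ))⁻¹)))))) ^ ((d + 2) * (L ^ r * L ^ kk)) - 1)) ≤ 3 * ((1 + Fintype.card ι * (@basisConst ι _ (Matrix mm mm ℂ) Matrix.frobeniusNormedAddCommGroup Matrix.frobeniusNormedSpace e * (2 * Real.sqrt (Fintype.card mm)) * (Real.sqrt (Fintype.card mm) * (2 * (rA * ((((L ^ r * L ^ kk : ℕ) : ℝ))⁻¹)))))) ^ ((d + 2) * (L ^ r * L ^ kk)) - 1) := by 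nlinarith
    calc |a| * (((1 + Fintype.card ι * (@basisConst ι _ (Matrix mm mm ℂ) Matrix.frobeniusNormedAddCommGroup Matrix.frobeniusNormedSpace e * (2 * Real.sqrt (Fintype.card mm)) * (Real.sqrt (Fintype.card mm) * (2 * (rA * ((((L ^ r * L ^ kk : ℕ) : ℝ))⁻¹)))))) ^ ((d + 2) * (L ^ r * L ^ kk)) - 1) * (2 + ((1 + Fintype.card ι * (@basisConst ι _ (Matrix mm mm ℂ) Matrix.frobeniusNormedAddCommGroup Matrix.frobeniusNormedSpace e * (2 * Real.sqrt (Fintype.card mm)) * (Real.sqrt (Fintype.card mm) * (2 * (rA * ((((L ^ r * L ^ kk : ℕ) : ℝ))⁻¹)))))) ^ ((d + 2) * (L ^ r * L ^ kk)) - 1)) * (B4Sect5Proof.latticeConst (d + 1) δ₂ * Real.exp (3 * δ₂))) ≤ |a| * (3 * ((1 + Fintype.card ι * (@basisConst ι _ (Matrix mm mm ℂ) Matrix.frobeniusNormedAddCommGroup Matrix.frobeniusNormedSpace e * (2 * Real.sqrt (Fintype.card mm)) * (Real.sqrt (Fintype.card mm) * (2 * (rA * ((((L ^ r * L ^ kk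 : ℕ) : ℝ))⁻¹)))))) ^ ((d + 2) * (L ^ r * L ^ kk)) - 1) * (B4Sect5Proof.latticeConst (d + 1) δ₂ * Real.exp (3 * δ₂))) := by gcongr
      _ = 3 * |a| * (B4Sect5Proof.latticeConst (d + 1) δ₂ * Real.exp (3 * δ₂)) * ((1 + Fintype.card ι * (@basisConst ι _ (Matrix mm mm ℂ) Matrix.frobeniusNormedAddCommGroup Matrix.frobeniusNormedSpace e * (2 * Real.sqrt (Fintype.card mm)) * (Real.sqrt (Fintype.card mm) * (2 * (rA * ((((L ^ r * L ^ kk : ℕ) : ℝ))⁻¹)))))) ^ ((d + 2) * (L ^ r * L ^ kk)) - 1) := by ring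
      _ ≤ Rq * ((1 + Fintype.card ι * (@basisConst ι _ (Matrix mm mm ℂ) Matrix.frobeniusNormedAddCommGroup Matrix.frobeniusNormedSpace e * (2 * Real.sqrt (Fintype.card mm)) * (Real.sqrt (Fintype.card mm) * (2 * (rA * ((((L ^ r * L ^ kk : ℕ) : ℝ))⁻¹)))))) ^ ((d + 2) * (L ^ r * L ^ kk)) - 1) := mul_le_mul_of_nonneg_right (by rw [hRqdef]; nlinarith [mul_nonneg (abs_nonneg a) hce1]) hKF0
      _ ≤ Rq * (((1 + Fintype.card ι * (@basisConst ι _ (Matrix mm mm ℂ) Matrix.frobeniusNormedAddCommGroup Matrix.frobeniusNormedSpace e * (2 * Real.sqrt (Fintype.card mm)) * (Real.sqrt (Fintype.card mm) * (2 * (rA * ((((L ^ kk : ℕ) : ℝ))⁻¹)))))) ^ ((d + 2) * L ^ kk) - 1) + ((1 + Fintype.card ι * (@basisConst ι _ (Matrix mm mm ℂ) Matrix.frobeniusNormedAddCommGroup Matrix.frobeniusNormedSpace e * (2 * Real.sqrt (Fintype.card mm)) * (Real.sqrt (Fintype.card mm) * (2 * (rA * ((((L ^ r * L ^ kk : ℕ)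 : ℝ))⁻¹)))))) ^ ((d + 2) * (L ^ r * L ^ kk)) - 1)) := mul_le_mul_of_nonneg_left (le_add_of_nonneg_left hKC0) hRq0
  have hRN0 : 0 ≤ Rq * (((1 + Fintype.card ι * (@basisConst ι _ (Matrix mm mm ℂ) Matrix.frobeniusNormedAddCommGroup Matrix.frobeniusNormedSpace e * (2 * Real.sqrt (Fintype.card mm)) * (Real.sqrt (Fintype.card mm) * (2 * (rA * ((((L ^ kk : ℕ) : ℝ))⁻¹)))))) ^ ((d + 2) * L ^ kk) - 1) + ((1 + Fintype.card ι * (@basisConst ι _ (Matrix mm mm ℂ) Matrix.frobeniusNormedAddCommGroup Matrix.frobeniusNormedSpace e * (2 * Real.sqrt (Fintype.card mm)) * (Real.sqrt (Fintype.card mm) * (2 * (rA * ((((L ^ r * L ^ kk : ℕ) : ℝ))⁻¹)))))) ^ ((d + 2) * (L ^ r * L ^ kk)) - 1)) := mul_nonneg hRq0 (add_nonneg hKC0 hKF0)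
  -- (P-Q) the one-grid rows of `N_V^Q` (coarse, FILE 120's norm) and of `N_V^Q′` (fine, FILE 122's norm)
  have rowC : ∀ (f χ : CvX d L mv kk hL → ℝ), (∀ x, |f x| ≤ 1) → (∀ x, |χ x| ≤ 1) →
      HasMaj (CvNorm d L mv kk hL ι) (CvNorm d L mv kk hL ι) (mulOp (fun p : CvX d L mv kk hL × ι => f p.1) ∘ₗ (cvNVq d L mv kk hL a ι e (fun μ x => NormedSpace.exp (((((L ^ kk : ℕ) : ℝ))⁻¹) • gavgM (Matrix mm mm ℂ) (Fin (d + 1)) (kingPrV L kk r (cvM d L mv kk hL)) A' μ x))) ∘ₗ mulOp (fun p : CvX d L mv kk hL × ι => χ p.1))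
        (fun y y' => Rq * (((1 + Fintype.card ι * (@basisConst ι _ (Matrix mm mm ℂ) Matrix.frobeniusNormedAddCommGroup Matrix.frobeniusNormedSpace e * (2 * Real.sqrt (Fintype.card mm)) * (Real.sqrt (Fintype.card mm) * (2 * (rA * ((((L ^ kk : ℕ) : ℝ))⁻¹)))))) ^ ((d + 2) * L ^ kk) - 1) + ((1 + Fintype.card ι * (@basisConst ι _ (Matrix mm mm ℂ) Matrix.frobeniusNormedAddCommGroup Matrix.frobeniusNormedSpace e * (2 * Real.sqrt (Fintype.card mm)) * (Real.sqrt (Fintype.card mm) * (2 * (rA * ((((L ^ r * L ^ kk : ℕ) : ℝ))⁻¹)))))) ^ ((d + 2) * (L ^ r * L ^ kk)) - 1)) * Real.exp (-(δ₁ * (unitTorusGeo L kk (cvM d L mv kk hL)).dist y y'))) := fun f χ hf hχ' =>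
    (cv_hasMaj_sandwich_cvNVq e mv kk hL a hρc0 hδ₁ hTr hTc f χ hf hχ').mono fun y y' => mul_le_mul_of_nonneg_right hconstC (Real.exp_nonneg _)
  have hNVf := hasMaj_nvQ (L := L) (cvM d L mv kk hL) kk (L ^ r * L ^ kk) (T := cvT e (fun μ x' => NormedSpace.exp (((((L ^ r * L ^ kk : ℕ) : ℝ))⁻¹) • A' μ x'))) hρf0 hδ₂ hTr' hTc' a
  have rowF : ∀ (f' χ' : CvX' d L mv kk r hL → ℝ), (∀ x', |f' x'| ≤ 1) → (∀ x', |χ' x'| ≤ 1) →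
      HasMaj (BlockNorm.ofBlocks (unitTorusGeo L kk (cvM d L mv kk hL)) (liftBlk (fun b : CvX' d L mv kk r hL => blockOf (L ^ r * L ^ kk) (cvM d L mv kk hL) b.1) ι))
        (BlockNorm.ofBlocks (unitTorusGeo L kk (cvM d L mv kk hL)) (liftBlk (fun b : CvX' d L mv kk r hL => blockOf (L ^ r * L ^ kk) (cvM d L mv kk hL) b.1) ι))
        (mulOp (fun p : CvX' d L mv kk r hL × ι => f' p.1) ∘ₗ (cvNVq' d L mv kk r hL a ι e (fun μ x' => NormedSpace.exp (((((L ^ r * L ^ kk : ℕ) : ℝ))⁻¹) • A' μ x'))) ∘ₗ mulOp (fun p : CvX' d L mv kk r hL × ι => χ' p.1))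
        (fun y y' => Rq * (((1 + Fintype.card ι * (@basisConst ι _ (Matrix mm mm ℂ) Matrix.frobeniusNormedAddCommGroup Matrix.frobeniusNormedSpace e * (2 * Real.sqrt (Fintype.card mm)) * (Real.sqrt (Fintype.card mm) * (2 * (rA * ((((L ^ kk : ℕ) : ℝ))⁻¹)))))) ^ ((d + 2) * L ^ kk) - 1) + ((1 + Fintype.card ι * (@basisConst ι _ (Matrix mm mm ℂ) Matrix.frobeniusNormedAddCommGroup Matrix.frobeniusNormedSpace e * (2 * Real.sqrt (Fintype.card mm)) * (Real.sqrt (Fintype.card mm) * (2 * (rA * ((((L ^ r * L ^ kk : ℕ) : ℝ))⁻¹)))))) ^ ((d + 2) * (L ^ r * L ^ kk)) - 1)) * Real.exp (-(δ₂ * (unitTorusGeo L kk (cvM d L mv kk hL)).dist y y'))) := fun f' χ' hf hχ' => by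
    refine hasMaj_sandwich_of_abs_le_one (g := unitTorusGeo L kk (cvM d L mv kk hL)) (liftBlk (fun b : CvX' d L mv kk r hL => blockOf (L ^ r * L ^ kk) (cvM d L mv kk hL) b.1) ι)
      (N := (cvNVq' d L mv kk r hL a ι e (fun μ x' => NormedSpace.exp (((((L ^ r * L ^ kk : ℕ) : ℝ))⁻¹) • A' μ x')))) (K := fun y y' => Rq * (((1 + Fintype.card ι * (@basisConst ι _ (Matrix mm mm ℂ) Matrix.frobeniusNormedAddCommGroup Matrix.frobeniusNormedSpace e * (2 * Real.sqrt (Fintype.card mm)) * (Real.sqrt (Fintype.card mm) * (2 * (rA * ((((L ^ kk : ℕ) : ℝ))⁻¹)))))) ^ ((d + 2) * L ^ kk) - 1) + ((1 + Fintype.card ι * (@basisConst ι _ (Matrix mm mm ℂ) Matrix.frobeniusNormedAddCommGroup Matrix.frobeniusNormedSpace e * (2 * Real.sqrt (Fintype.card mm)) * (Real.sqrt (Fintype.card mm) * (2 * (rA * ((((L ^ r * L ^ kk : ℕ) : ℝ))⁻¹)))))) ^ ((d + 2) * (L ^ r * L ^ kk)) - 1)) * Real.exp (-(δ₂ * (unitTorusGeo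 L kk (cvM d L mv kk hL)).dist y y')))
      (ψ := fun p : CvX' d L mv kk r hL × ι => f' p.1) (χ := fun p : CvX' d L mv kk r hL × ι => χ' p.1) (fun p => hf p.1) (fun p => hχ' p.1)
      (fun y y' => mul_nonneg hRN0 (Real.exp_nonneg _)) ?_
    exact hNVf.mono fun y y' => by rw [unitTorusGeo_dist]; exact mul_le_mul_of_nonneg_right hconstF (Real.exp_nonneg _)
  -- (P-R) the displayed Landau rows: rate `δ_e` weakened to the knit's rates `δ₁, δ₂ ≤ δ_e`, fine blocks respelled, then sandwiched between cut-offs bounded by one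
  have hRNρ : 0 ≤ Rq * (((1 + Fintype.card ι * (@basisConst ι _ (Matrix mm mm ℂ) Matrix.frobeniusNormedAddCommGroup Matrix.frobeniusNormedSpace e * (2 * Real.sqrt (Fintype.card mm)) * (Real.sqrt (Fintype.card mm) * (2 * (rA * ((((L ^ kk : ℕ) : ℝ))⁻¹)))))) ^ ((d + 2) * L ^ kk) - 1) + ((1 + Fintype.card ι * (@basisConst ι _ (Matrix mm mm ℂ) Matrix.frobeniusNormedAddCommGroup Matrix.frobeniusNormedSpace e * (2 * Real.sqrt (Fintype.card mm)) * (Real.sqrt (Fintype.card mm) * (2 * (rA * ((((L ^ r * L ^ kk : ℕ) : ℝ))⁻¹)))))) ^ ((d + 2) * (L ^ r * L ^ kk)) - 1)) + ρR := add_nonneg hRN0 hρR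
  have hbk : cvBlk d L mv kk hL ∘ kingPrV L kk r (cvM d L mv kk hL) = fun i' : CvX' d L mv kk r hL => blockOf (L ^ r * L ^ kk) (cvM d L mv kk hL) i'.1 :=
    blkFine_comp_kingPrV (M := cvM d L mv kk hL) L kk r
  have hGr1 : HasMaj (CvNorm d L mv kk hL ι) (CvNorm d L mv kk hL ι) (cvNVr d L mv kk hL a ι e (fun μ x => NormedSpace.exp (((((L ^ kk : ℕ) : ℝ))⁻¹) • gavgM (Matrix mm mm ℂ) (Fin (d + 1)) (kingPrV L kk r (cvM d L mv kk hL)) A' μ x))) (fun y y' => ρR * Real.exp (-(δ₁ * (unitTorusGeo L kk (cvM d L mv kk hL)).dist y y'))) :=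
    hGr.mono fun y y' => mul_le_mul_of_nonneg_left (Real.exp_le_exp.mpr (neg_le_neg (mul_le_mul_of_nonneg_right hδ₁e (unitTorusGeo_dist_nonneg L kk (cvM d L mv kk hL) y y')))) hρR
  have hGr2 : HasMaj (BlockNorm.ofBlocks (unitTorusGeo L kk (cvM d L mv kk hL)) (liftBlk (fun b : CvX' d L mv kk r hL => blockOf (L ^ r * L ^ kk) (cvM d L mv kk hL) b.1) ι)) (BlockNorm.ofBlocks (unitTorusGeo L kk (cvM d L mv kk hL)) (liftBlk (fun b : CvX' d L mv kk r hL => blockOf (L ^ r * L ^ kk) (cvM d L mv kk hL) b.1) ι)) (cvNVr' d L mv kk r hL a ι e (fun μ x' => NormedSpace.exp (((((L ^ r * L ^ kk : ℕ) : ℝ))⁻¹) • A' μ x'))) (fun y y' => ρR * Real.exp (-(δ₂ * (unitTorusGeo L kk (cvM d L mv kk hL)).dist y y'))) := by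
    have h := hGr'
    rw [hbk] at h
    exact h.mono fun y y' => mul_le_mul_of_nonneg_left (Real.exp_le_exp.mpr (neg_le_neg (mul_le_mul_of_nonneg_right hδ₂e (unitTorusGeo_dist_nonneg L kk (cvM d L mv kk hL) y y')))) hρR
  have rowRC : ∀ (f χ : CvX d L mv kk hL → ℝ), (∀ x, |f x| ≤ 1) → (∀ x, |χ x| ≤ 1) →
      HasMaj (CvNorm d L mv kk hL ι) (CvNorm d L mv kk hL ι) (mulOp (fun p : CvX d L mv kk hL × ι => f p.1) ∘ₗ (cvNVr d L mv kk hL a ι e (fun μ x => NormedSpace.exp (((((L ^ kk : ℕ) : ℝ))⁻¹) • gavgM (Matrix mm mm ℂ) (Fin (d + 1)) (kingPrV L kk r (cvM d L mv kk hL)) A' μ x))) ∘ₗ mulOp (fun p : CvX d L mv kk hL × ι => χ p.1))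
        (fun y y' => ρR * Real.exp (-(δ₁ * (unitTorusGeo L kk (cvM d L mv kk hL)).dist y y'))) := fun f χ hf hχ' =>
    hasMaj_sandwich_of_abs_le_one (g := unitTorusGeo L kk (cvM d L mv kk hL)) (liftBlk (cvBlk d L mv kk hL) ι) (N := (cvNVr d L mv kk hL a ι e (fun μ x => NormedSpace.exp (((((L ^ kk : ℕ) : ℝ))⁻¹) • gavgM (Matrix mm mm ℂ) (Fin (d + 1)) (kingPrV L kk r (cvM d L mv kk hL)) A' μ x))))
      (K := fun y y' => ρR * Real.exp (-(δ₁ * (unitTorusGeo L kk (cvM d L mv kk hL)).dist y y')))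
      (ψ := fun p : CvX d L mv kk hL × ι => f p.1) (χ := fun p : CvX d L mv kk hL × ι => χ p.1) (fun p => hf p.1) (fun p => hχ' p.1)
      (fun y y' => mul_nonneg hρR (Real.exp_nonneg _)) hGr1
  have rowRF : ∀ (f' χ' : CvX' d L mv kk r hL → ℝ), (∀ x', |f' x'| ≤ 1) → (∀ x', |χ' x'| ≤ 1) →
      HasMaj (BlockNorm.ofBlocks (unitTorusGeo L kk (cvM d L mv kk hL)) (liftBlk (fun b : CvX' d L mv kk r hL => blockOf (L ^ r * L ^ kk) (cvM d L mv kk hL) b.1) ι)) (BlockNorm.ofBlocks (unitTorusGeo L kk (cvM d L mv kk hL)) (liftBlk (fun b : CvX' d L mv kk r hL => blockOf (L ^ r * L ^ kk) (cvM d L mv kk hL) b.1) ι)) (mulOp (fun p : CvX' d L mv kk r hL × ι => f' p.1) ∘ₗ (cvNVr' d L mv kk r hL a ι e (fun μ x' => NormedSpace.exp (((((L ^ r * L ^ kk : ℕ) : ℝ))⁻¹) • A' μ x'))) ∘ₗ mulOp (fun p : CvX' d L mv kk r hL × ι => χ' p.1))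
        (fun y y' => ρR * Real.exp (-(δ₂ * (unitTorusGeo L kk (cvM d L mv kk hL)).dist y y'))) := fun f' χ' hf hχ' =>
    hasMaj_sandwich_of_abs_le_one (g := unitTorusGeo L kk (cvM d L mv kk hL)) (liftBlk (fun b : CvX' d L mv kk r hL => blockOf (L ^ r * L ^ kk) (cvM d L mv kk hL) b.1) ι) (N := (cvNVr' d L mv kk r hL a ι e (fun μ x' => NormedSpace.exp (((((L ^ r * L ^ kk : ℕ) : ℝ))⁻¹) • A' μ x'))))
      (K := fun y y' => ρR * Real.exp (-(δ₂ * (unitTorusGeo L kk (cvM d L mv kk hL)).dist y y')))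
      (ψ := fun p : CvX' d L mv kk r hL × ι => f' p.1) (χ := fun p : CvX' d L mv kk r hL × ι => χ' p.1) (fun p => hf p.1) (fun p => hχ' p.1)
      (fun y y' => mul_nonneg hρR (Real.exp_nonneg _)) hGr2
  have hsplitC : ∀ (Z : (CvX d L mv kk hL × ι → ℝ) →ₗ[ℝ] (CvX d L mv kk hL × ι → ℝ)) (χ : CvX d L mv kk hL → ℝ),
      Z ∘ₗ ((cvNVq d L mv kk hL a ι e (fun μ x => NormedSpace.exp (((((L ^ kk : ℕ) : ℝ))⁻¹) • gavgM (Matrix mm mm ℂ) (Fin (d + 1)) (kingPrV L kk r (cvM d L mv kk hL)) A' μ x))) + (cvNVr d L mv kk hL a ι e (fun μ x => NormedSpace.exp (((((L ^ kk : ℕ) : ℝ))⁻¹) • gavgM (Matrix mm mm ℂ) (Fin (d + 1)) (kingPrV L kk r (cvM d L mv kk hL)) A' μ x)))) ∘ₗ mulOp (fun p : CvX d L mv kk hL × ι => χ p.1) =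
        Z ∘ₗ (cvNVq d L mv kk hL a ι e (fun μ x => NormedSpace.exp (((((L ^ kk : ℕ) : ℝ))⁻¹) • gavgM (Matrix mm mm ℂ) (Fin (d + 1)) (kingPrV L kk r (cvM d L mv kk hL)) A' μ x))) ∘ₗ mulOp (fun p : CvX d L mv kk hL × ι => χ p.1) + Z ∘ₗ (cvNVr d L mv kk hL a ι e (fun μ x => NormedSpace.exp (((((L ^ kk : ℕ) : ℝ))⁻¹) • gavgM (Matrix mm mm ℂ) (Fin (d + 1)) (kingPrV L kk r (cvM d L mv kk hL)) A' μ x))) ∘ₗ mulOp (fun p : CvX d L mv kk hL × ι => χ p.1) := fun Z χ => by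
    rw [LinearMap.add_comp, LinearMap.comp_add]
  have hsplitF : ∀ (Z : (CvX' d L mv kk r hL × ι → ℝ) →ₗ[ℝ] (CvX' d L mv kk r hL × ι → ℝ)) (χ' : CvX' d L mv kk r hL → ℝ),
      Z ∘ₗ ((cvNVq' d L mv kk r hL a ι e (fun μ x' => NormedSpace.exp (((((L ^ r * L ^ kk : ℕ) : ℝ))⁻¹) • A' μ x'))) + (cvNVr' d L mv kk r hL a ι e (fun μ x' => NormedSpace.exp (((((L ^ r * L ^ kk : ℕ) : ℝ))⁻¹) • A' μ x')))) ∘ₗ mulOp (fun p : CvX' d L mv kk r hL × ι => χ' p.1) =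
        Z ∘ₗ (cvNVq' d L mv kk r hL a ι e (fun μ x' => NormedSpace.exp (((((L ^ r * L ^ kk : ℕ) : ℝ))⁻¹) • A' μ x'))) ∘ₗ mulOp (fun p : CvX' d L mv kk r hL × ι => χ' p.1) + Z ∘ₗ (cvNVr' d L mv kk r hL a ι e (fun μ x' => NormedSpace.exp (((((L ^ r * L ^ kk : ℕ) : ℝ))⁻¹) • A' μ x'))) ∘ₗ mulOp (fun p : CvX' d L mv kk r hL × ι => χ' p.1) := fun Z χ' => by
    rw [LinearMap.add_comp, LinearMap.comp_add]
  -- the scale conditions at each level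
  have hR₁le : (14 * Real.exp 1 * (1 + Fintype.card (Fin (d + 1))) * basisConst e * ((1 + Fintype.card (Fin (d + 1))) * ((3 + 2 * ((d : ℝ) + 1)) * rA))) * (1 + Fintype.card (Fin (d + 1) ⊕ Fin (d + 1))) + (Rq * (((1 + Fintype.card ι * (@basisConst ι _ (Matrix mm mm ℂ) Matrix.frobeniusNormedAddCommGroup Matrix.frobeniusNormedSpace e * (2 * Real.sqrt (Fintype.card mm)) * (Real.sqrt (Fintype.card mm) * (2 * (rA * ((((L ^ kk : ℕ) : ℝ))⁻¹)))))) ^ ((d + 2) * L ^ kk) - 1) + ((1 + Fintype.card ι * (@basisConst ι _ (Matrix mm mm ℂ) Matrix.frobeniusNormedAddCommGroup Matrix.frobeniusNormedSpace e * (2 * Real.sqrt (Fintype.card mm)) * (Real.sqrt (Fintype.card mm) * (2 * (rA * ((((L ^ r * L ^ kk : ℕ) : ℝ))⁻¹)))))) ^ ((d + 2) * (L ^ r * L ^ kk)) - 1)) + ρR) ≤ R₁' :=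
    (add_assoc _ _ _).symm.trans_le (hRle.trans (min_le_left _ _))
  have hR₂le : (14 * Real.exp 1 * (1 + Fintype.card (Fin (d + 1))) * basisConst e * ((1 + Fintype.card (Fin (d + 1))) * ((3 + 2 * ((d : ℝ) + 1)) * rA))) * (1 + Fintype.card (Fin (d + 1) ⊕ Fin (d + 1))) + (Rq * (((1 + Fintype.card ι * (@basisConst ι _ (Matrix mm mm ℂ) Matrix.frobeniusNormedAddCommGroup Matrix.frobeniusNormedSpace e * (2 * Real.sqrt (Fintype.card mm)) * (Real.sqrt (Fintype.card mm) * (2 * (rA * ((((L ^ kk : ℕ) : ℝ))⁻¹)))))) ^ ((d + 2) * L ^ kk) - 1) + ((1 + Fintype.card ι * (@basisConst ι _ (Matrix mm mm ℂ) Matrix.frobeniusNormedAddCommGroup Matrix.frobeniusNormedSpace e * (2 * Real.sqrt (Fintype.card mm)) * (Real.sqrt (Fintype.card mm) * (2 * (rA * ((((L ^ r * L ^ kk : ℕ) : ℝ))⁻¹)))))) ^ ((d + 2) * (L ^ r * L ^ kk)) - 1)) + ρR) ≤ R₂ :=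
    (add_assoc _ _ _).symm.trans_le (hRle.trans (min_le_right _ _))
  have hθ₁le : Rq * (((1 + Fintype.card ι * (@basisConst ι _ (Matrix mm mm ℂ) Matrix.frobeniusNormedAddCommGroup Matrix.frobeniusNormedSpace e * (2 * Real.sqrt (Fintype.card mm)) * (Real.sqrt (Fintype.card mm) * (2 * (rA * ((((L ^ kk : ℕ) : ℝ))⁻¹)))))) ^ ((d + 2) * L ^ kk) - 1) + ((1 + Fintype.card ι * (@basisConst ι _ (Matrix mm mm ℂ) Matrix.frobeniusNormedAddCommGroup Matrix.frobeniusNormedSpace e * (2 * Real.sqrt (Fintype.card mm)) * (Real.sqrt (Fintype.card mm) * (2 * (rA * ((((L ^ r * L ^ kk : ℕ) : ℝ))⁻¹)))))) ^ ((d + 2) * (L ^ r * L ^ kk)) - 1)) + ρR ≤ θ₁ := hθle.trans (min_le_left _ _)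
  have hθ₂le : Rq * (((1 + Fintype.card ι * (@basisConst ι _ (Matrix mm mm ℂ) Matrix.frobeniusNormedAddCommGroup Matrix.frobeniusNormedSpace e * (2 * Real.sqrt (Fintype.card mm)) * (Real.sqrt (Fintype.card mm) * (2 * (rA * ((((L ^ kk : ℕ) : ℝ))⁻¹)))))) ^ ((d + 2) * L ^ kk) - 1) + ((1 + Fintype.card ι * (@basisConst ι _ (Matrix mm mm ℂ) Matrix.frobeniusNormedAddCommGroup Matrix.frobeniusNormedSpace e * (2 * Real.sqrt (Fintype.card mm)) * (Real.sqrt (Fintype.card mm) * (2 * (rA * ((((L ^ r * L ^ kk : ℕ) : ℝ))⁻¹)))))) ^ ((d + 2) * (L ^ r * L ^ kk)) - 1)) + ρR ≤ θ₂ := hθle.trans (min_le_right _ _)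
  obtain ⟨hG, hGi₁, hGi₂⟩ := H₁ mv kk hk hw₁ e he (fun _ _ => (1 : Matrix mm mm ℂ)) (fun _ _ => by rw [Matrix.conjTranspose_one, Matrix.mul_one]) (fun μ x => NormedSpace.exp (((((L ^ kk : ℕ) : ℝ))⁻¹) • gavgM (Matrix mm mm ℂ) (Fin (d + 1)) (kingPrV L kk r (cvM d L mv kk hL)) A' μ x)) (cvNL d L mv kk hL a ι - (cvNVq d L mv kk hL a ι e (fun μ x => NormedSpace.exp (((((L ^ kk : ℕ) : ℝ))⁻¹) • gavgM (Matrix mm mm ℂ) (Fin (d + 1)) (kingPrV L kk r (cvM d L mv kk hL)) A' μ x))) - (cvNVr d L mv kk hL a ι e (fun μ x => NormedSpace.exp (((((L ^ kk : ℕ) : ℝ))⁻¹) • gavgM (Matrix mm mm ℂ) (Fin (d + 1)) (kingPrV L kk r (cvM d L mv kk hL)) A' μ x)))) (fun _ => (cvNVq d L mv kk hL a ι e (fun μ x => NormedSpace.exp (((((L ^ kk : ℕ) : ℝ))⁻¹) • gavgM (Matrix mm mm ℂ) (Fin (d + 1)) (kingPrV L kk r (cvM d L mv kk hL)) A' μ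 x))) + (cvNVr d L mv kk hL a ι e (fun μ x => NormedSpace.exp (((((L ^ kk : ℕ) : ℝ))⁻¹) • gavgM (Matrix mm mm ℂ) (Fin (d + 1)) (kingPrV L kk r (cvM d L mv kk hL)) A' μ x))))
    (14 * Real.exp 1 * (1 + Fintype.card (Fin (d + 1))) * basisConst e * ((1 + Fintype.card (Fin (d + 1))) * ((3 + 2 * ((d : ℝ) + 1)) * rA))) (Rq * (((1 + Fintype.card ι * (@basisConst ι _ (Matrix mm mm ℂ) Matrix.frobeniusNormedAddCommGroup Matrix.frobeniusNormedSpace e * (2 * Real.sqrt (Fintype.card mm)) * (Real.sqrt (Fintype.card mm) * (2 * (rA * ((((L ^ kk : ℕ) : ℝ))⁻¹)))))) ^ ((d + 2) * L ^ kk) - 1) + ((1 + Fintype.card ι * (@basisConst ι _ (Matrix mm mm ℂ) Matrix.frobeniusNormedAddCommGroup Matrix.frobeniusNormedSpace e * (2 * Real.sqrt (Fintype.card mm)) * (Real.sqrt (Fintype.card mm) * (2 * (rA * ((((L ^ r * L ^ kk : ℕ) : ℝ))⁻¹)))))) ^ ((d + 2) * (L ^ r * L ^ kk)) - 1)) + ρR)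 (Rq * (((1 + Fintype.card ι * (@basisConst ι _ (Matrix mm mm ℂ) Matrix.frobeniusNormedAddCommGroup Matrix.frobeniusNormedSpace e * (2 * Real.sqrt (Fintype.card mm)) * (Real.sqrt (Fintype.card mm) * (2 * (rA * ((((L ^ kk : ℕ) : ℝ))⁻¹)))))) ^ ((d + 2) * L ^ kk) - 1) + ((1 + Fintype.card ι * (@basisConst ι _ (Matrix mm mm ℂ) Matrix.frobeniusNormedAddCommGroup Matrix.frobeniusNormedSpace e * (2 * Real.sqrt (Fintype.card mm)) * (Real.sqrt (Fintype.card mm) * (2 * (rA * ((((L ^ r * L ^ kk : ℕ) : ℝ))⁻¹)))))) ^ ((d + 2) * (L ^ r * L ^ kk)) - 1)) + ρR) hS0 hRNρ hRNρ hR₁le hθ₁le (fun k => by rw [conj_one_eq_sub_zero, sub_zero, sub_sub])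
    (fun k x _ i => hc x i) (fun k j' x _ i => hcA j' x i)
    (fun k => by rw [hsplitC]; exact ((rowC (cvPsi d L mv kk hL k) (cvChi d L mv kk hL k) (hψ1 k) (hχ1 k)).add (rowRC (cvPsi d L mv kk hL k) (cvChi d L mv kk hL k) (hψ1 k) (hχ1 k))).mono fun y y' => (add_mul _ _ _).symm.le)
    (fun k => by rw [hid k, hsplitC]; exact ((rowC (1 - cvPsi d L mv kk hL k) (cvChi d L mv kk hL k) (h1ψ k) (hχ1 k)).add (rowRC (1 - cvPsi d L mv kk hL k) (cvChi d L mv kk hL k) (h1ψ k) (hχ1 k))).mono fun y y' => (add_mul _ _ _).symm.le)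
  obtain ⟨hG', hGi₁', hGi₂'⟩ := H₂ mv kk r hk hw₂ e he (fun _ _ => (1 : Matrix mm mm ℂ)) (fun _ _ => by rw [Matrix.conjTranspose_one, Matrix.mul_one]) (fun μ x' => NormedSpace.exp (((((L ^ r * L ^ kk : ℕ) : ℝ))⁻¹) • A' μ x')) (cvNL' d L mv kk r hL a ι - (cvNVq' d L mv kk r hL a ι e (fun μ x' => NormedSpace.exp (((((L ^ r * L ^ kk : ℕ) : ℝ))⁻¹) • A' μ x'))) - (cvNVr' d L mv kk r hL a ι e (fun μ x' => NormedSpace.exp (((((L ^ r * L ^ kk : ℕ) : ℝ))⁻¹) • A' μ x')))) (fun _ => (cvNVq' d L mv kk r hL a ι e (fun μ x' => NormedSpace.exp (((((L ^ r * L ^ kk : ℕ) : ℝ))⁻¹) • A' μ x'))) + (cvNVr' d L mv kk r hL a ι e (fun μ x' => NormedSpace.exp (((((L ^ r * L ^ kk : ℕ) : ℝ))⁻¹) • A' μ x'))))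
    (14 * Real.exp 1 * (1 + Fintype.card (Fin (d + 1))) * basisConst e * ((1 + Fintype.card (Fin (d + 1))) * ((3 + 2 * ((d : ℝ) + 1)) * rA))) (Rq * (((1 + Fintype.card ι * (@basisConst ι _ (Matrix mm mm ℂ) Matrix.frobeniusNormedAddCommGroup Matrix.frobeniusNormedSpace e * (2 * Real.sqrt (Fintype.card mm)) * (Real.sqrt (Fintype.card mm) * (2 * (rA * ((((L ^ kk : ℕ) : ℝ))⁻¹)))))) ^ ((d + 2) * L ^ kk) - 1) + ((1 + Fintype.card ι * (@basisConst ι _ (Matrix mm mm ℂ) Matrix.frobeniusNormedAddCommGroup Matrix.frobeniusNormedSpace e * (2 * Real.sqrt (Fintype.card mm)) * (Real.sqrt (Fintype.card mm) * (2 * (rA * ((((L ^ r * L ^ kk : ℕ) : ℝ))⁻¹)))))) ^ ((d + 2) * (L ^ r * L ^ kk)) - 1)) + ρR) (Rq * (((1 + Fintype.card ι * (@basisConst ι _ (Matrix mm mm ℂ) Matrix.frobeniusNormedAddCommGroup Matrix.frobeniusNormedSpace e * (2 * Real.sqrt (Fintype.card mm)) * (Real.sqrt (Fintype.card mm) * (2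 * (rA * ((((L ^ kk : ℕ) : ℝ))⁻¹)))))) ^ ((d + 2) * L ^ kk) - 1) + ((1 + Fintype.card ι * (@basisConst ι _ (Matrix mm mm ℂ) Matrix.frobeniusNormedAddCommGroup Matrix.frobeniusNormedSpace e * (2 * Real.sqrt (Fintype.card mm)) * (Real.sqrt (Fintype.card mm) * (2 * (rA * ((((L ^ r * L ^ kk : ℕ) : ℝ))⁻¹)))))) ^ ((d + 2) * (L ^ r * L ^ kk)) - 1)) + ρR) hS0 hRNρ hRNρ hR₂le hθ₂le (fun k => by rw [conj_one_eq_sub_zero, sub_zero, sub_sub])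
    (fun k x' _ i => hc' x' i) (fun k j' x' _ i => hcA' j' x' i)
    (fun k => by rw [hsplitF]; exact ((rowF (cvPsi' d L mv kk r hL k) (cvChi' d L mv kk r hL k) (hψ1' k) (hχ1' k)).add (rowRF (cvPsi' d L mv kk r hL k) (cvChi' d L mv kk r hL k) (hψ1' k) (hχ1' k))).mono fun y y' => (add_mul _ _ _).symm.le)
    (fun k => by rw [hid' k, hsplitF]; exact ((rowF (1 - cvPsi' d L mv kk r hL k) (cvChi' d L mv kk r hL k) (h1ψ' k) (hχ1' k)).add (rowRF (1 - cvPsi' d L mv kk r hL k) (cvChi' d L mv kk r hL k) (h1ψ' k) (hχ1' k))).mono fun y y' => (add_mul _ _ _).symm.le)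
  refine ⟨⟨hG.mono fun y y' => ?_, hGi₁, hGi₂⟩, ⟨hG'.mono fun y y' => ?_, hGi₁', hGi₂'⟩⟩
  · have hd0 := unitTorusGeo_dist_nonneg L kk (cvM d L mv kk hL) y y'
    exact mul_le_mul (le_max_left _ _) (Real.exp_le_exp.mpr (neg_le_neg (mul_le_mul_of_nonneg_right (min_le_left _ _) hd0))) (Real.exp_nonneg _)
      ((hB₁.le).trans (le_max_left _ _))
  · have hd0 := unitTorusGeo_dist_nonneg L kk (cvM d L mv kk hL) y y'
    exact mul_le_mul (le_max_right _ _) (Real.exp_le_exp.mpr (neg_le_neg (mul_le_mul_of_nonneg_right (min_le_right _ _) hd0))) (Real.exp_nonneg _)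
      ((hB₁.le).trans (le_max_left _ _))

end Pair

end Summit.QuantumFields.YangMills.BalabanUVNodes.N15.Gluing

end
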